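import Literature.MathematicalPhysics.QuantumManyBody.PeriodicBoseGasLemma33
import Literature.MathematicalPhysics.QuantumManyBody.PeriodicBoseGasThm31
import Mathlib.MeasureTheory.Integral.Pi
import Mathlib.Analysis.SpecialFunctions.Trigonometric.Deriv

/-!
# Negative lemmas for crux `StaticResponseBound` — II: trigonometric toolkit on the cell

Supports stmt-AtomisticToContinuum-12057.  The phase `θ_k(x) = (2π/L)∑kᵢxᵢ` (`arg`), `∫_cell cos θ_k = 0`
for `k ≠ 0` (`integral_cell_cos_arg`, via the tree's `integral_cell_cellWave_eq_zero`),
`integral_cell_trig_combo`, the modulated constant mode `φ_ε = 1 + 2ε cos θ_k` (`phiMode`) with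
`∫φ_ε² = (1+2ε²)L³`, `∫cos θ_k φ_ε² = 2εL³`, its derivative (`hasFDerivAt_phiMode`, `argCLM`), and
Fubini for one-body products on `cell²` (`integral_cellN_two_mul`).
-/

namespace Summit.AtomisticToContinuum.BoseEinsteinCondensation.Theorems.StaticResponseBound.Negative

open MeasureTheory
open scoped ENNReal
open Literature.MathematicalPhysics.QuantumManyBody.BoseGas

noncomputable section

/-! ## §T  Toolkit: the phase `θ_k`, cosine integrals on the cell, the modulated mode `φ_ε` -/

/-- The crux's cosine argument `θ_k(x) = (2π/L) ∑ᵢ kᵢ xᵢ = p·x`. [folklore] -/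
def arg (L : ℝ) (k : Fin 3 → ℤ) (x : Space) : ℝ :=
  2 * Real.pi / L * ∑ i, (k i : ℝ) * x i

/-- `θ_{m k} = m θ_k`. [folklore] -/
theorem arg_intSMul (L : ℝ) (m : ℤ) (k : Fin 3 → ℤ) (x : Space) :
    arg L (m • k) x = m * arg L k x := by
  unfold arg
  simp only [Pi.smul_apply, smul_eq_mul, Int.cast_mul, Finset.mul_sum]
  refine Finset.sum_congr rfl fun i _ => ?_
  ring

/-- `Re e_k(x) = cos θ_k(x)`. [folklore] -/
theorem re_cellWave (L : ℝ) (k : Fin 3 → ℤ) (x : Space) :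
    (cellWave L k x).re = Real.cos (arg L k x) := by
  rw [cellWave_apply]
  have : (2 * Real.pi * Complex.I * (∑ i, (k i : ℝ) * x i : ℝ) / L : ℂ) =
      ((arg L k x : ℝ) : ℂ) * Complex.I := by
    unfold arg
    push_cast
    ring
  push_cast at this ⊢
  rw [this, Complex.exp_ofReal_mul_I_re]

/-- `∫_{[0,L)³} cos θ_k = 0` for `k ≠ 0`. [folklore] -/
theorem integral_cell_cos_arg {L : ℝ} (hL : 0 < L) {k : Fin 3 → ℤ} (hk : k ≠ 0) :
    ∫ x in cell L, Real.cos (arg L k x) = 0 := by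
  have h := integral_cell_cellWave_eq_zero hL hk
  have hint : Integrable (cellWave L k) (volume.restrict (cell L)) :=
    integrableOn_cell (continuous_cellWave L k)
  have h2 := integral_re hint
  simp only [RCLike.re_to_complex, re_cellWave] at h2
  rw [h2, h, Complex.zero_re]

/-- `∫_{[0,L)³} c = c L³`. [folklore] -/
theorem integral_cell_const {L : ℝ} (hL : 0 < L) (c : ℝ) :
    ∫ _ in cell L, c = c * L ^ 3 := by
  rw [setIntegral_const, measureReal_def, volume_cell, ← ENNReal.ofReal_pow hL.le,
    ENNReal.toReal_ofReal (by positivity), smul_eq_mul, mul_comm]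

/-- The modulated constant mode `φ_ε(x) = 1 + 2ε cos θ_k(x)` (real). [folklore] -/
def phiMode (L : ℝ) (k : Fin 3 → ℤ) (ε : ℝ) (x : Space) : ℝ :=
  1 + 2 * ε * Real.cos (arg L k x)

/-- `θ_k` is continuous. [folklore] -/
@[fun_prop]
theorem continuous_arg (L : ℝ) (k : Fin 3 → ℤ) : Continuous (arg L k) := by
  unfold arg; fun_prop

/-- `θ_k` is `C¹`. [folklore] -/
@[fun_prop]
theorem contDiff_arg (L : ℝ) (k : Fin 3 → ℤ) : ContDiff ℝ 1 (arg L k) := by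
  unfold arg; fun_prop

/-- `φ_ε` is continuous. [folklore] -/
@[fun_prop]
theorem continuous_phiMode (L : ℝ) (k : Fin 3 → ℤ) (ε : ℝ) : Continuous (phiMode L k ε) := by
  unfold phiMode; fun_prop

/-- `φ_ε` is `C¹`. [folklore] -/
@[fun_prop]
theorem contDiff_phiMode (L : ℝ) (k : Fin 3 → ℤ) (ε : ℝ) : ContDiff ℝ 1 (phiMode L k ε) := by
  unfold phiMode; fun_prop

/-- `θ_k(x + L e_a) = θ_k(x) + 2π k_a`. [folklore] -/
theorem arg_add_single {L : ℝ} (hL : L ≠ 0) (k : Fin 3 → ℤ) (x : Space) (a : Fin 3) :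
    arg L k (x + EuclideanSpace.single a L) = arg L k x + 2 * Real.pi * k a := by
  unfold arg
  simp only [PiLp.add_apply, PiLp.single_apply, mul_add, mul_ite, mul_zero,
    Finset.sum_add_distrib, Finset.sum_ite_eq', Finset.mem_univ, if_true]
  field_simp

/-- `φ_ε` is `Lℤ³`-periodic. [folklore] -/
theorem phiMode_periodic {L : ℝ} (hL : L ≠ 0) (k : Fin 3 → ℤ) (ε : ℝ) (x : Space) (a : Fin 3) :
    phiMode L k ε (x + EuclideanSpace.single a L) = phiMode L k ε x := by
  unfold phiMode
  rw [arg_add_single hL, show arg L k x + 2 * Real.pi * (k a : ℝ) =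
    arg L k x + ((k a : ℤ) : ℝ) * (2 * Real.pi) by ring, Real.cos_add_int_mul_two_pi]

/-- `φ_ε ≥ 1 - 2|ε|`; in particular `φ_ε > 0` for `|ε| < 1/2`. [folklore] -/
theorem phiMode_pos {L : ℝ} {k : Fin 3 → ℤ} {ε : ℝ} (hε : |ε| < 1 / 2) (x : Space) :
    0 < phiMode L k ε x := by
  unfold phiMode
  have h1 := Real.abs_cos_le_one (arg L k x)
  have : |2 * ε * Real.cos (arg L k x)| ≤ 2 * |ε| := by
    rw [abs_mul, abs_mul, abs_two]
    nlinarith [abs_nonneg ε]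
  have := neg_abs_le (2 * ε * Real.cos (arg L k x))
  linarith

/-- Pointwise trigonometry: `φ_ε² = (1 + 2ε²) + 4ε cos θ_k + 2ε² cos θ_{2k}`. [folklore] -/
theorem phiMode_sq (L : ℝ) (k : Fin 3 → ℤ) (ε : ℝ) (x : Space) :
    phiMode L k ε x ^ 2 =
      (1 + 2 * ε ^ 2) + 4 * ε * Real.cos (arg L k x) + 2 * ε ^ 2 * Real.cos (arg L ((2 : ℤ) • k) x) := by
  unfold phiMode
  rw [arg_intSMul, show ((2 : ℤ) : ℝ) * arg L k x = 2 * arg L k x by push_cast; ring, Real.cos_two_mul]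
  ring

/-- Pointwise trigonometry: `cos θ_k · φ_ε² = 2ε + (1 + 3ε²) cos θ_k + 2ε cos θ_{2k} + ε² cos θ_{3k}`. [folklore] -/
theorem cos_mul_phiMode_sq (L : ℝ) (k : Fin 3 → ℤ) (ε : ℝ) (x : Space) :
    Real.cos (arg L k x) * phiMode L k ε x ^ 2 =
      2 * ε + (1 + 3 * ε ^ 2) * Real.cos (arg L k x) + 2 * ε * Real.cos (arg L ((2 : ℤ) • k) x)
        + ε ^ 2 * Real.cos (arg L ((3 : ℤ) • k) x) := by
  unfold phiMode
  rw [arg_intSMul, arg_intSMul,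
    show ((2 : ℤ) : ℝ) * arg L k x = 2 * arg L k x by push_cast; ring,
    show ((3 : ℤ) : ℝ) * arg L k x = 3 * arg L k x by push_cast; ring,
    Real.cos_two_mul, Real.cos_three_mul]
  ring

/-- The cell has finite volume. [folklore] -/
theorem isFiniteMeasure_restrict_cell (L : ℝ) : IsFiniteMeasure (volume.restrict (cell L)) := by
  refine ⟨?_⟩
  rw [Measure.restrict_apply_univ, volume_cell]
  exact ENNReal.pow_lt_top ENNReal.ofReal_lt_top

/-- `∫_{[0,L)³} (a + b cos θ_k + c cos θ_{2k} + d cos θ_{3k}) = a L³` for `k ≠ 0`. [folklore] -/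
theorem integral_cell_trig_combo {L : ℝ} (hL : 0 < L) {k : Fin 3 → ℤ} (hk : k ≠ 0)
    (a b c d : ℝ) :
    ∫ x in cell L, (a + b * Real.cos (arg L k x) + c * Real.cos (arg L ((2 : ℤ) • k) x)
      + d * Real.cos (arg L ((3 : ℤ) • k) x)) = a * L ^ 3 := by
  haveI := isFiniteMeasure_restrict_cell L
  have h2k : (2 : ℤ) • k ≠ 0 := smul_ne_zero (by norm_num) hk
  have h3k : (3 : ℤ) • k ≠ 0 := smul_ne_zero (by norm_num) hk
  have i0 : Integrable (fun _ : Space => a) (volume.restrict (cell L)) := integrable_const _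
  have c1 : Integrable (fun x => Real.cos (arg L k x)) (volume.restrict (cell L)) :=
    integrableOn_cell (by fun_prop)
  have c2 : Integrable (fun x => Real.cos (arg L ((2 : ℤ) • k) x)) (volume.restrict (cell L)) :=
    integrableOn_cell (by fun_prop)
  have c3 : Integrable (fun x => Real.cos (arg L ((3 : ℤ) • k) x)) (volume.restrict (cell L)) :=
    integrableOn_cell (by fun_prop)
  have i1 : Integrable (fun x => b * Real.cos (arg L k x)) (volume.restrict (cell L)) :=
    c1.const_mul b
  have i2 : Integrable (fun x => c * Real.cos (arg L ((2 : ℤ) • k) x)) (volume.restrict (cell L)) :=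
    c2.const_mul c
  have i3 : Integrable (fun x => d * Real.cos (arg L ((3 : ℤ) • k) x)) (volume.restrict (cell L)) :=
    c3.const_mul d
  have i01 : Integrable (fun x => a + b * Real.cos (arg L k x)) (volume.restrict (cell L)) :=
    i0.add i1
  have i012 : Integrable (fun x => a + b * Real.cos (arg L k x) + c * Real.cos (arg L ((2 : ℤ) • k) x))
      (volume.restrict (cell L)) := i01.add i2
  rw [integral_add i012 i3, integral_add i01 i2, integral_add i0 i1]
  simp only [integral_const_mul, integral_cell_cos_arg hL hk, integral_cell_cos_arg hL h2k,
    integral_cell_cos_arg hL h3k, integral_cell_const hL, mul_zero, add_zero]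

/-- `∫_{[0,L)³} φ_ε² = (1 + 2ε²) L³`. [folklore] -/
theorem integral_cell_phiMode_sq {L : ℝ} (hL : 0 < L) {k : Fin 3 → ℤ} (hk : k ≠ 0) (ε : ℝ) :
    ∫ x in cell L, phiMode L k ε x ^ 2 = (1 + 2 * ε ^ 2) * L ^ 3 := by
  have : (fun x => phiMode L k ε x ^ 2) = fun x => ((1 + 2 * ε ^ 2) + (4 * ε) * Real.cos (arg L k x)
      + (2 * ε ^ 2) * Real.cos (arg L ((2 : ℤ) • k) x) + 0 * Real.cos (arg L ((3 : ℤ) • k) x)) := by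
    funext x; rw [phiMode_sq]; ring
  rw [this, integral_cell_trig_combo hL hk]

/-- `∫_{[0,L)³} cos θ_k φ_ε² = 2ε L³` — the first-order density modulation of `φ_ε`. [folklore] -/
theorem integral_cell_cos_mul_phiMode_sq {L : ℝ} (hL : 0 < L) {k : Fin 3 → ℤ} (hk : k ≠ 0) (ε : ℝ) :
    ∫ x in cell L, Real.cos (arg L k x) * phiMode L k ε x ^ 2 = 2 * ε * L ^ 3 := by
  have : (fun x => Real.cos (arg L k x) * phiMode L k ε x ^ 2) = fun x => ((2 * ε)
      + (1 + 3 * ε ^ 2) * Real.cos (arg L k x) + (2 * ε) * Real.cos (arg L ((2 : ℤ) • k) x)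
      + ε ^ 2 * Real.cos (arg L ((3 : ℤ) • k) x)) := by
    funext x; rw [cos_mul_phiMode_sq]
  rw [this, integral_cell_trig_combo hL hk]

/-- Fubini for a product of one-body factors on `cell²`. [folklore] -/
theorem integral_cellN_two_mul {L : ℝ} (f g : Space → ℝ) :
    ∫ X in cellN 2 L, f (X 0) * g (X 1) = (∫ x in cell L, f x) * ∫ x in cell L, g x := by
  rw [volume_restrict_cellN]
  have h := integral_fin_nat_prod_eq_prod (𝕜 := ℝ)
    (μ := fun _ : Fin 2 => (volume : Measure Space).restrict (cell L)) ![f, g]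
  simp only [Fin.prod_univ_two, Matrix.cons_val_zero, Matrix.cons_val_one] at h
  exact h

/-- The phase as a continuous linear functional: `θ_k = (2π/L) ∑ᵢ kᵢ projᵢ`. [folklore] -/
def argCLM (L : ℝ) (k : Fin 3 → ℤ) : Space →L[ℝ] ℝ :=
  (2 * Real.pi / L) • ∑ i : Fin 3, (k i : ℝ) • PiLp.proj (𝕜 := ℝ) 2 (fun _ : Fin 3 => ℝ) i

/-- `argCLM` is `θ_k`. [folklore] -/
theorem argCLM_apply (L : ℝ) (k : Fin 3 → ℤ) (x : Space) : argCLM L k x = arg L k x := by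
  simp [argCLM, arg]

/-- `θ_k(e_j) = 2π k_j / L`. [folklore] -/
theorem argCLM_single (L : ℝ) (k : Fin 3 → ℤ) (j : Fin 3) :
    argCLM L k (EuclideanSpace.single j (1 : ℝ)) = 2 * Real.pi / L * k j := by
  rw [argCLM_apply]
  unfold arg
  congr 1
  simp [PiLp.single_apply, Finset.sum_ite_eq']

/-- `dφ_ε(x) = -2ε sin θ_k(x) · θ_k`. [folklore] -/
theorem hasFDerivAt_phiMode (L : ℝ) (k : Fin 3 → ℤ) (ε : ℝ) (x : Space) :
    HasFDerivAt (phiMode L k ε) ((2 * ε * -Real.sin (arg L k x)) • argCLM L k) x := by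
  have h1 : HasFDerivAt (fun y => Real.cos (argCLM L k y))
      ((-Real.sin (argCLM L k x)) • argCLM L k) x :=
    (Real.hasDerivAt_cos (argCLM L k x)).comp_hasFDerivAt x (argCLM L k).hasFDerivAt
  have h2 := (h1.const_mul (2 * ε)).const_add 1
  rw [argCLM_apply, smul_smul] at h2
  have hfun : (fun y => 1 + 2 * ε * Real.cos (argCLM L k y)) = phiMode L k ε := by
    funext y; rw [argCLM_apply]; rfl
  rw [hfun] at h2
  exact h2

end

end Summit.AtomisticToContinuum.BoseEinsteinCondensation.Theorems.StaticResponseBound.Negative
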